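import Literature.Algebra.Homology.GroupCohomologySemilinear
import HarnessLib

/-!
# Group cohomology does not see the scalars: `Hⁿ(G, A|_ℤ) ≅ Hⁿ(G, A)`

Topic `Algebra/Homology`; namespace `Literature.Algebra.Homology`; two definitions with bodies
(the restriction of scalars `Rep.intRep : Rep k G → Rep ℤ G` and the tautological semilinear map)
and theorems, continuing `GroupCohomologySemilinear`.

For a representation `A` of `G` over a commutative ring `k`, let `A|_ℤ` (`intRep A`) be the same
abelian group with the same action, viewed over `ℤ`.  The identity `A|_ℤ → A` is
`ℤ → k`-semilinear and equivariant, so it acts on Mathlib's `groupCohomology` (`semimap`,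
`GroupCohomologySemilinear`); **this map `Hⁿ(G, A|_ℤ) → Hⁿ(G, A)` is a bijection**
(`semimap_intRep_bijective`): inhomogeneous cochains, cocycles and coboundaries are the same
functions `Gⁿ → V` whatever the ring of scalars ([Brown1982CohomologyGroups, III.1 Example 3]: the
standard coboundary only involves the action, sums and signs; `d_intRep_apply`).  Hence
**`Hⁿ(G, A)` is finite iff `Hⁿ(G, A|_ℤ)` is** (`finite_groupCohomology_iff_intRep`) — used to feed
finiteness statements for `Rep ℤ` (the Borel–Serre named fact
`BorelSerre1973_finite_groupCohomology_congruenceSubgroup`) into cohomology with coefficients over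
`𝒪/ϖ^r`, `𝒪`, … (Hida theory, `hidaControl_dominantOrdinaryPoint`).

## References

* K. S. Brown, *Cohomology of Groups*, GTM 87 (1982), III.1 Example 3 (standard cochains) (held).
  [Brown1982CohomologyGroups]
-/

noncomputable section

open CategoryTheory groupCohomology

namespace Literature.Algebra.Homology

variable {k : Type} [CommRing k] {G : Type} [Group G] (A : Rep.{0} k G)

/-! ### Restriction of scalars to `ℤ` -/

/-- The action of `G` on `A` by `ℤ`-linear (additive) maps. [folklore] -/
def intRepresentation : Representation ℤ G A.V where
  toFun g := (A.ρ g).toAddMonoidHom.toIntLinearMap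
  map_one' := by
    refine LinearMap.ext fun v => ?_
    simp
  map_mul' g h := by
    refine LinearMap.ext fun v => ?_
    simp

/-- **`A|_ℤ`: the representation `A` viewed over `ℤ`** (same abelian group, same action).
[folklore] -/
abbrev intRep : Rep.{0} ℤ G :=
  Rep.of (intRepresentation A)

/-- The action of `A|_ℤ` is that of `A`. [folklore] -/
@[simp]
theorem intRep_ρ_apply (g : G) (v : A.V) : (intRep A).ρ g v = A.ρ g v :=
  rfl

/-- The identity `A|_ℤ → A` as a `ℤ → k`-semilinear map. [folklore] -/
def ofIntRep : (intRep A).V →ₛₗ[Int.castRingHom k] A.V where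
  toFun v := v
  map_add' _ _ := rfl
  map_smul' n v := by
    change (n • (show A.V from v) : A.V) = ((Int.castRingHom k n) • (show A.V from v) : A.V)
    rw [eq_intCast]
    exact (Int.cast_smul_eq_zsmul k n _).symm

/-- `ofIntRep` is the identity on elements. [folklore] -/
@[simp]
theorem ofIntRep_apply (v : (intRep A).V) : ofIntRep A v = (v : A.V) :=
  rfl

/-- `ofIntRep` is equivariant. [folklore] -/
theorem ofIntRep_equivariant (g : G) (v : (intRep A).V) :
    ofIntRep A ((intRep A).ρ g v) = A.ρ g (ofIntRep A v) :=
  rfl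

/-! ### The coboundary is the same -/

/-- `(-1)^m • v` over `k` is the integer multiple `(-1)^m • v`. [folklore] -/
theorem neg_one_pow_smul_eq_zsmul (m : ℕ) (v : A.V) : ((-1 : k) ^ m) • v = ((-1 : ℤ) ^ m) • v := by
  rw [← Int.cast_smul_eq_zsmul k, Int.cast_pow, Int.cast_neg, Int.cast_one]

/-- **The standard coboundaries of `A` and `A|_ℤ` are the same function.**
[cite: Brown1982CohomologyGroups, III.1 Example 3] -/
theorem d_intRep_apply (n : ℕ) (f : (Fin n → G) → A.V) (g : Fin (n + 1) → G) :
    inhomogeneousCochains.d (intRep A) n f g = inhomogeneousCochains.d A n f g := by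
  rw [inhomogeneousCochains.d_hom_apply, inhomogeneousCochains.d_hom_apply]
  change A.ρ (g 0) _ + _ = A.ρ (g 0) _ + _
  congr 1
  exact Finset.sum_congr rfl fun j _ => by rw [neg_one_pow_smul_eq_zsmul]

/-- The same for Mathlib's differentials `d i j` of the complex of inhomogeneous cochains.
[folklore] -/
theorem d_intRep_eq (i j : ℕ) (w : (Fin i → G) → A.V) :
    ((inhomogeneousCochains (intRep A)).d i j w : (Fin j → G) → A.V) =
      (inhomogeneousCochains A).d i j w := by
  by_cases hij : i + 1 = j
  · subst hij
    rw [inhomogeneousCochains.d_def, inhomogeneousCochains.d_def]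
    funext g
    exact d_intRep_apply A i w g
  · rw [(inhomogeneousCochains A).shape i j hij, (inhomogeneousCochains (intRep A)).shape i j hij]
    rfl

/-! ### `Hⁿ(G, A|_ℤ) ≅ Hⁿ(G, A)` -/

/-- **`Hⁿ(G, A|_ℤ) → Hⁿ(G, A)` is a bijection** (cocycles and coboundaries are the same functions).
[cite: Brown1982CohomologyGroups, III.1 Example 3] -/
theorem semimap_intRep_bijective (n : ℕ) :
    Function.Bijective (semimap (ofIntRep A) (ofIntRep_equivariant A) n) := by
  refine ⟨fun x₁ x₂ h => ?_, fun y => ?_⟩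
  · -- injectivity: a coboundary witness over `k` is one over `ℤ`
    rw [← sub_eq_zero, ← map_sub] at h
    rw [← sub_eq_zero]
    obtain ⟨z, hz⟩ := π_surjective (intRep A) n (x₁ - x₂)
    rw [← hz] at h ⊢
    rw [semimap_π, π_apply_eq_zero_iff] at h
    obtain ⟨w, hw⟩ := h
    rw [π_apply_eq_zero_iff]
    refine ⟨(w : (Fin (n - 1) → G) → A.V), ?_⟩
    refine iCocycles_injective (intRep A) n ?_
    have hw' := congrArg (fun c => ((iCocycles A n) c : (Fin n → G) → A.V)) hw
    simp only at hw'
    rw [iCocycles_toCocycles, iCocycles_cocyclesSemimap] at hw'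
    rw [iCocycles_toCocycles, d_intRep_eq]
    funext x
    have hx := congr_fun hw' x
    rw [cochainsSemimap_apply] at hx
    exact hx
  · -- surjectivity: a cocycle over `k` is one over `ℤ`
    obtain ⟨z, rfl⟩ := π_surjective A n y
    have hd : inhomogeneousCochains.d (intRep A) n (iCocycles A n z : (Fin n → G) → A.V) = 0 := by
      funext g
      rw [d_intRep_apply]
      exact congr_fun (d_iCocycles A n z) g
    refine ⟨groupCohomology.π (intRep A) n (cocyclesMk _ hd), ?_⟩
    rw [semimap_π]
    congr 1
    refine iCocycles_injective A n ?_
    rw [iCocycles_cocyclesSemimap, iCocycles_mk]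
    funext x
    rw [cochainsSemimap_apply]
    rfl

/-- **`Hⁿ(G, A)` is finite iff `Hⁿ(G, A|_ℤ)` is.** [cite: Brown1982CohomologyGroups, III.1 Example 3] -/
theorem finite_groupCohomology_iff_intRep (n : ℕ) :
    Finite (groupCohomology A n) ↔ Finite (groupCohomology (intRep A) n) :=
  (Equiv.finite_iff (Equiv.ofBijective _ (semimap_intRep_bijective A n))).symm

/-- `A|_ℤ` is finite with `A`. [folklore] -/
theorem finite_intRep_iff : Finite (intRep A) ↔ Finite A :=
  Iff.rfl

end Literature.Algebra.Homology
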